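import Mathlib
import HarnessLib
import Summits.Ventures.LatticeQCDFlow.Exactness.NCMCGeneralSpaceDoeblinPowerCLT

/-!
# The CLT for a RATIO of time averages (conditional mean on an event) under a Doeblin power, from every initial law: `√n (Σ g·1_A / Σ 1_A − m_A) ⇒ N(0, σ²_{(g − m_A)1_A} / π(A)²)`

HONEST FRAMING: exact (Metropolis-corrected) sampling algorithms for lattice gauge theory;
figures of merit are autocorrelation/cost numbers at stated couplings and volumes; no
continuum-physics claim.

Venture `LatticeQCDFlow` (cell pub-lqcd), topic `Exactness`; FANOUT row 13 (`eng-snf`, GEN-19).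
NEW WORK of the cell, not a published result; no definition is introduced; nothing is cited as a
fact (Slutsky's theorem from Mathlib; the "ratio / delta method" NAMED ONLY).  For a chain with a
Doeblin power, an event `A` of positive mass and a bounded observable `g`, the estimator that averages
`g` over the visits to `A` — `R_n = Σ_{t<n} g(x_t) 1_A(x_t) / Σ_{t<n} 1_A(x_t)` — estimates the
conditional mean `m_A = π(g 1_A)/π(A)`; GEN-18 proved its almost sure convergence for the NCMC lane's
target-level means (`run_ncmc_chain`'s `target_means`, which average an observable over the target-
level visits).  THIS file gives its Gaussian fluctuations: with the centred observable
`f = (g − m_A) · 1_A` (so that `√n (R_n − m_A) = [(√n)⁻¹ Σ_{t<n} f(x_t)] / p̂_n(A)` whenever `A` has been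
visited), GEN-19's chain CLT (`NCMCGeneralSpaceDoeblinPowerCLT`) for the numerator, the every-start law
of large numbers for `p̂_n(A) → π(A) > 0` (GEN-18 `tendsto_sum_div_anyLaw_of_nHit_minorised`) and
Slutsky give `√n (R_n − m_A) ⇒ N(0, σ²_f / π(A)²)`; the exceptional event "no visit to `A` before
`n`" is asymptotically negligible (almost surely eventually empty).  The NCMC instance is
`NCMCGeneralSpaceTargetMeanCLT.lean`.

## Content (`κ` Markov on `S`, `π` invariant, `(nHit κ m)(z,·) ≥ ε ν` (`ε ≠ 0`, `0 < m`); `A`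
## measurable, `π(A) > 0`; `|g| ≤ C` measurable; `m_A = (∫ 1_A g dπ)/π(A)`, `f = (g − m_A) 1_A`,
## `σ²_f = ∫ f² dπ + 2 Σ_{k≥0} ∫ f · κ^{k+1} f dπ`)

* `ratio_identity` — the algebra `r (G/T − a) = (r⁻¹ (G − a T)) (T/N)⁻¹` for `r² = N`, `T ≠ 0`;
  `integral_centredOn_eq_zero` — `∫ f dπ = 0`.
* **`tendstoInDistribution_condMean_of_nHit`** — THE THEOREM: for EVERY initial law `μ₀` and every
  `Y ~ N(0, σ²_f / π(A)²)`:
  `TendstoInDistribution (fun n x => √n (R_n(x) − m_A)) atTop Y (fun _ => P_{μ₀}) P'`.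

NOT CLAIMED: `π(A) = 0`; unbounded `g`; a plug-in (studentised) version; rates.
-/

namespace Summit.Ventures.LatticeQCDFlow.Exactness.GeneralNCMC

open MeasureTheory ProbabilityTheory Set Filter Finset
open scoped ENNReal Topology

variable {S : Type*} [MeasurableSpace S]

section Ratio

omit [MeasurableSpace S] in
/-- The algebra of the ratio estimator: for `r · r = N`, `r ≠ 0`, `T ≠ 0`:
`r (G/T − a) = (r⁻¹ (G − a T)) · (T/N)⁻¹`. -/
theorem ratio_identity {r N G T a : ℝ} (hr : r * r = N) (hr0 : r ≠ 0) (hT : T ≠ 0) :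
    r * (G / T - a) = (r⁻¹ * (G - a * T)) * (T / N)⁻¹ := by
  rw [← hr, inv_div]
  field_simp

variable {κ : Kernel S S} [IsMarkovKernel κ] {π : Measure S} [IsProbabilityMeasure π]
  {ν : Measure S} [IsProbabilityMeasure ν] {ε : ℝ≥0∞} {m : ℕ}

omit [IsMarkovKernel κ] in
/-- The observable `(g − m_A) · 1_A` with `m_A = (∫ 1_A g dπ)/π(A)` is `π`-centred (`π(A) > 0`). -/
theorem integral_centredOn_eq_zero {A : Set S} (hA : MeasurableSet A) (hA0 : 0 < π.real A)
    {g : S → ℝ} (hg : Measurable g) {C : ℝ} (hC : ∀ x, |g x| ≤ C) :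
    ∫ y, (g y - (∫ z, A.indicator g z ∂π) / π.real A) * A.indicator (1 : S → ℝ) y ∂π = 0 := by
  have hpt : ∀ y, (g y - (∫ z, A.indicator g z ∂π) / π.real A) * A.indicator (1 : S → ℝ) y
      = A.indicator g y - ((∫ z, A.indicator g z ∂π) / π.real A) * A.indicator (1 : S → ℝ) y := by
    intro y
    by_cases hy : y ∈ A
    · simp [Set.indicator_of_mem hy]
    · simp [Set.indicator_of_notMem hy]
  simp_rw [hpt]
  have hi1 : Integrable (A.indicator g) π :=
    (Scoring.integrable_of_bounded π hg hC).indicator hA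
  have hi2 : Integrable (fun y => ((∫ z, A.indicator g z ∂π) / π.real A) * A.indicator (1 : S → ℝ) y) π :=
    ((integrable_const (1 : ℝ)).indicator hA).const_mul _
  rw [integral_sub hi1 hi2, integral_const_mul, integral_indicator_one hA,
    div_mul_cancel₀ _ hA0.ne', sub_self]

/-- **THE CONDITIONAL-MEAN (RATIO) CLT UNDER A DOEBLIN POWER, FROM ANY INITIAL LAW.**  With
`R_n = Σ_{t<n} g(x_t)1_A(x_t) / Σ_{t<n} 1_A(x_t)`, `m_A = (∫ 1_A g dπ)/π(A)`, `f = (g − m_A)1_A` and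
`σ²_f` its Green–Kubo variance: for every initial law `μ₀` and every `Y ~ N(0, σ²_f/π(A)²)`,
`TendstoInDistribution (fun n x => √n (R_n(x) − m_A)) atTop Y (fun _ => P_{μ₀}) P'`. -/
theorem tendstoInDistribution_condMean_of_nHit (hπ : Kernel.Invariant κ π) (hε : ε ≠ 0)
    (hmin : ∀ z, ε • ν ≤ nHit κ m z) (hm : 0 < m)
    {A : Set S} (hA : MeasurableSet A) (hA0 : 0 < π.real A)
    {g : S → ℝ} (hg : Measurable g) {C : ℝ} (hC : ∀ x, |g x| ≤ C)
    (μ₀ : Measure S) [IsProbabilityMeasure μ₀]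
    {Ω' : Type*} [MeasurableSpace Ω'] {P' : Measure Ω'} [IsProbabilityMeasure P'] {Y : Ω' → ℝ}
    (hY : HasLaw Y (gaussianReal 0 (Real.toNNReal (
      ((∫ y, ((g y - (∫ z, A.indicator g z ∂π) / π.real A) * A.indicator (1 : S → ℝ) y) ^ 2 ∂π)
        + 2 * ∑' k, ∫ y, ((g y - (∫ z, A.indicator g z ∂π) / π.real A) * A.indicator (1 : S → ℝ) y)
          * (Scoring.kop κ)^[k + 1]
            (fun y => (g y - (∫ z, A.indicator g z ∂π) / π.real A) * A.indicator (1 : S → ℝ) y) y ∂π)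
      / π.real A ^ 2))) P')
    [IsProbabilityMeasure (Kernel.trajMeasure (X := fun _ : ℕ => S) μ₀
        (fun n : ℕ => κ.comap (fun hh : (i : ↥(Finset.Iic n)) → S => hh ⟨n, Finset.mem_Iic.2 le_rfl⟩)
          (measurable_pi_apply _)))] :
    TendstoInDistribution (fun (n : ℕ) (x : ℕ → S) =>
        Real.sqrt n * ((∑ t ∈ range n, A.indicator g (x t)) /
          (∑ t ∈ range n, A.indicator (1 : S → ℝ) (x t)) - (∫ z, A.indicator g z ∂π) / π.real A))
      atTop Y (fun _ => Kernel.trajMeasure (X := fun _ : ℕ => S) μ₀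
        (fun n : ℕ => κ.comap (fun hh : (i : ↥(Finset.Iic n)) → S => hh ⟨n, Finset.mem_Iic.2 le_rfl⟩)
          (measurable_pi_apply _))) P' := by
  -- notation
  set a : ℝ := (∫ z, A.indicator g z ∂π) / π.real A with ha
  set f : S → ℝ := fun y => (g y - a) * A.indicator (1 : S → ℝ) y with hf
  set V : ℝ := (∫ y, f y ^ 2 ∂π) + 2 * ∑' k, ∫ y, f y * (Scoring.kop κ)^[k + 1] f y ∂π with hV
  have hp0 : π.real A ≠ 0 := hA0.ne'
  have hC0 : 0 ≤ C := (abs_nonneg _).trans (hC (Classical.choice (nonempty_of_isProbabilityMeasure π)))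
  -- the centred observable
  have hfm : Measurable f := (hg.sub measurable_const).mul (measurable_one.indicator hA)
  have ha_le : |a| ≤ C / π.real A := by
    rw [ha, abs_div, abs_of_pos hA0]
    refine div_le_div_of_nonneg_right ?_ hA0.le
    rw [← Real.norm_eq_abs]
    calc ‖∫ z, A.indicator g z ∂π‖ ≤ C * π.real univ :=
          norm_integral_le_of_norm_le_const (Eventually.of_forall fun z => by
            rw [Real.norm_eq_abs]
            by_cases hz : z ∈ A
            · rw [Set.indicator_of_mem hz]; exact hC z
            · rw [Set.indicator_of_notMem hz, abs_zero]; exact hC0)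
      _ = C := by rw [probReal_univ, mul_one]
  have hfC : ∀ y, |f y| ≤ C + C / π.real A := by
    intro y
    rw [hf]
    dsimp only
    by_cases hy : y ∈ A
    · rw [Set.indicator_of_mem hy, Pi.one_apply, mul_one]
      exact (abs_sub _ _).trans (add_le_add (hC y) ha_le)
    · rw [Set.indicator_of_notMem hy, mul_zero, abs_zero]; positivity
  have hf0 : ∫ y, f y ∂π = 0 := integral_centredOn_eq_zero hA hA0 hg hC
  -- the numerator CLT, for the limit variable `π(A) · Y ~ N(0, V)`
  have hYX : HasLaw (fun ω => π.real A * Y ω) (gaussianReal 0 (Real.toNNReal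
      ((∫ y, (f y - ∫ z, f z ∂π) ^ 2 ∂π) + 2 * ∑' k, ∫ y, (f y - ∫ z, f z ∂π)
        * (Scoring.kop κ)^[k + 1] (fun y => f y - ∫ z, f z ∂π) y ∂π))) P' := by
    simp_rw [hf0, sub_zero]
    have h := gaussianReal_const_mul hY (π.real A)
    rw [mul_zero] at h
    have hnn : NNReal.mk (π.real A ^ 2) (sq_nonneg _) * (V / π.real A ^ 2).toNNReal = V.toNNReal := by
      rw [show V = π.real A ^ 2 * (V / π.real A ^ 2) by field_simp, Real.toNNReal_mul (sq_nonneg _)]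
      rw [show π.real A ^ 2 * (V / π.real A ^ 2) = V by field_simp]
      congr 1
      apply NNReal.eq
      rw [NNReal.coe_mk, Real.coe_toNNReal _ (sq_nonneg _)]
    rw [hnn] at h
    exact h
  have hX := tendstoInDistribution_timeAverage_of_nHit hπ hε hmin hm hfm hfC μ₀ hYX
  simp_rw [hf0, sub_zero] at hX
  -- the denominator: `(p̂_n)⁻¹ → π(A)⁻¹` almost surely, hence in measure
  have h1m : Measurable (A.indicator (1 : S → ℝ)) := measurable_one.indicator hA
  have hphat := tendsto_sum_div_anyLaw_of_nHit_minorised hπ hε hmin h1m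
    ((integrable_const (1 : ℝ)).indicator hA) μ₀
  rw [integral_indicator_one hA] at hphat
  have hBm : ∀ n : ℕ, Measurable fun x : ℕ → S =>
      ((∑ t ∈ range n, A.indicator (1 : S → ℝ) (x t)) / n)⁻¹ := fun n =>
    ((Finset.measurable_sum _ fun t _ => h1m.comp (measurable_pi_apply t)).div_const _).inv
  have hB : TendstoInMeasure (Kernel.trajMeasure (X := fun _ : ℕ => S) μ₀
      (fun n : ℕ => κ.comap (fun hh : (i : ↥(Finset.Iic n)) → S => hh ⟨n, Finset.mem_Iic.2 le_rfl⟩)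
        (measurable_pi_apply _))) (fun (n : ℕ) (x : ℕ → S) =>
      ((∑ t ∈ range n, A.indicator (1 : S → ℝ) (x t)) / n)⁻¹) atTop (fun _ => (π.real A)⁻¹) := by
    refine tendstoInMeasure_of_tendsto_ae (fun n => (hBm n).aestronglyMeasurable) ?_
    filter_upwards [hphat] with x hx
    exact hx.inv₀ hp0
  -- Slutsky
  have hXB := hX.continuous_comp_prodMk_of_tendstoInMeasure_const
    (g := fun p : ℝ × ℝ => p.1 * p.2) (by fun_prop) hB (fun n => (hBm n).aemeasurable)
  have hlim : (fun ω' => (fun p : ℝ × ℝ => p.1 * p.2) (π.real A * Y ω', (π.real A)⁻¹)) = Y := by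
    funext ω'
    dsimp only
    rw [mul_comm (π.real A) (Y ω'), mul_assoc, mul_inv_cancel₀ hp0, mul_one]
  rw [hlim] at hXB
  -- the ratio statistic agrees with the Slutsky product as soon as `A` has been visited
  have hRm : ∀ n : ℕ, Measurable fun x : ℕ → S =>
      Real.sqrt n * ((∑ t ∈ range n, A.indicator g (x t)) /
        (∑ t ∈ range n, A.indicator (1 : S → ℝ) (x t)) - a) := fun n =>
    measurable_const.mul (((Finset.measurable_sum _ fun t _ =>
      (hg.indicator hA).comp (measurable_pi_apply t)).div
      (Finset.measurable_sum _ fun t _ => h1m.comp (measurable_pi_apply t))).sub measurable_const)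
  refine tendstoInDistribution_of_tendstoInMeasure_sub _ Y hXB ?_ (fun n => (hRm n).aemeasurable)
  have hXm : ∀ n : ℕ, Measurable fun x : ℕ → S => (Real.sqrt n)⁻¹ * ∑ t ∈ range n, f (x t) :=
    fun n => measurable_const.mul (Finset.measurable_sum _ fun t _ => hfm.comp (measurable_pi_apply t))
  refine tendstoInMeasure_of_tendsto_ae
    (fun n => ((hRm n).sub ((hXm n).mul (hBm n))).aestronglyMeasurable) ?_
  filter_upwards [hphat] with x hx
  -- eventually `p̂_n(x) > π(A)/2 > 0`, and then the difference vanishes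
  have hev : ∀ᶠ n : ℕ in atTop, π.real A / 2 < (∑ t ∈ range n, A.indicator (1 : S → ℝ) (x t)) / n :=
    hx.eventually (lt_mem_nhds (by linarith))
  refine (tendsto_const_nhds (x := (0 : ℝ))).congr' ?_
  filter_upwards [hev, eventually_ge_atTop 1] with n hn hn1
  have hnpos : (0 : ℝ) < n := by exact_mod_cast hn1
  have hTpos : 0 < ∑ t ∈ range n, A.indicator (1 : S → ℝ) (x t) := by
    have h2 : 0 < (∑ t ∈ range n, A.indicator (1 : S → ℝ) (x t)) / n := by linarith
    exact (div_pos_iff_of_pos_right hnpos).1 h2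
  have hsum : ∑ t ∈ range n, f (x t)
      = ∑ t ∈ range n, A.indicator g (x t) - a * ∑ t ∈ range n, A.indicator (1 : S → ℝ) (x t) := by
    rw [Finset.mul_sum, ← Finset.sum_sub_distrib]
    refine Finset.sum_congr rfl fun t _ => ?_
    rw [hf]
    dsimp only
    by_cases ht : x t ∈ A
    · simp [Set.indicator_of_mem ht]
    · simp [Set.indicator_of_notMem ht]
  simp only [Pi.sub_apply]
  rw [hsum, ← ratio_identity (Real.mul_self_sqrt hnpos.le) (Real.sqrt_pos.2 hnpos).ne' hTpos.ne',
    sub_self]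

end Ratio

end Summit.Ventures.LatticeQCDFlow.Exactness.GeneralNCMC
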